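import Summits.SmoothPoincare4.SmoothPoincare4.Theses.ConvexBisection
import Summits.SmoothPoincare4.SmoothPoincare4.Theorems.ConvexBisectionAcyclicBisectionExistsStubExchange
import Summits.SmoothPoincare4.SmoothPoincare4.Theorems.ConvexBisectionAcyclicBisectionExistsStubSortBiSpan
import Summits.SmoothPoincare4.SmoothPoincare4.Theorems.ConvexBisectionAcyclicBisectionExistsStubReductionLift
import Summits.SmoothPoincare4.SmoothPoincare4.Theorems.ConvexBisectionAcyclicBisectionExistsStubReachInvariants
import Summits.SmoothPoincare4.SmoothPoincare4.Theorems.ConvexBisectionAcyclicBisectionExistsStubSortedModelOf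
import Literature.Topology.FourManifolds.LefschetzHandlebody
import Literature.Topology.FourManifolds.LefschetzModelFacts
import Literature.Topology.FourManifolds.HomotopyS4CompactProofs
import Literature.Topology.FourManifolds.CerfGammaFour
import Literature.GroupTheory.CombinatorialGroupTheory.SignedHurwitzAction
import Literature.GroupTheory.CombinatorialGroupTheory.SignedHurwitzStabilisation
import Literature.GroupTheory.CombinatorialGroupTheory.SignedHurwitzReach
import HarnessLib

/-!
# Fold certificates of line `folded-curve-branch-locus` (crux `ConvexBisection.AcyclicBisectionRigidity`,
# item stmt-SmoothPoincare4-10507; lead a4, reshape s3, 2026-08-17)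

Three sorry-free helpers (registered `helper_*` stubs of the crux item, landed `--supports`), all pure
logic over Literature / Mathlib names and the LANDED algebra of crux 10508's line `modp-braid-orbits`
(`stub_exchange`, `stub_reachInvariants`, `stub_sortBiSpan`, `hurwitzOrbit_lift`):

* `helper_foldedNormalForm_of_facts` — **the folded normal form of a homotopy 4-sphere from the four
  named facts of the Lefschetz dictionary** (`modelsOnFibred_exists`, `modelsOn_counts_of_homotopyEquiv_sphere`,
  `modelsOnFibred_balance_of_homotopyEquiv_sphere`, `modelsOnFibred_of_reach`, unproved `def … : Prop` of
  `LefschetzModelFacts.lean`): every `M ≃ₕ S⁴` has a SORTED, ALLOWABLE, BALANCED, BI-SPANNING fibred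
  Lefschetz model `ModelsOnFibred M g (P ++ N)` — the conclusion of the planner's Stub A of this line,
  reached WITHOUT any Stein bisection (audit finding of the lead's worker A; chain = that of
  `stub_sortedModelOfHandleSplitting_of`).
* `helper_spc4_of_foldRecognition_of_facts` — **fold recognition in every genus implies the summit,
  modulo the same four facts**: the line's Transfer `C⁺` ("homotopy 4-spheres with a folded fibred model
  are `S⁴`") is SPC4-EQUIVALENT, so its apex `stub_higherGenusFold` (fold genus `≥ 2`) is summit-sized once
  the genus-`0` rung (landed: `…StubUnfoldedSphere.lean`, modulo Cerf) and the genus-`1` rung (Matsumoto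
  1985, below) are granted.  This is the kernel-checked certificate behind the lead's line verdict.
* `helper_genusOneFold_of_stubs` — **the genus-`1` rung from Matsumoto's normal form**: pure logic showing
  how the registered `stub_genusOneFold` follows from NF2, NF4, Cerf and the four reshaped D-stubs of the
  skeleton (`stub_genusOnePrimitive`, `stub_matsumotoNormalForm`, `stub_genusOneDet`,
  `stub_genusOneTopRecognition`), each taken as an explicit hypothesis, statements verbatim.

Sources: Y. Matsumoto, *Torus fibrations over the 2-sphere with the simplest singular fibers*, J. Math.
Soc. Japan 37 (1985), Thm. 3.2; Etnyre–Fuller, IMRN 2006, Thm. 1 / Prop. 12 / eq. (d3); Baykur, AGT 6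
(2006), Lemma 1, §5; Gompf–Stipsicz 1999 §8.2.  Evidence on the item: `genus1_census.md` (worker D),
`stub_foldedNormalForm_AUDIT.md` (worker A).
-/

noncomputable section

open scoped Manifold ContDiff Topology ContinuousMap
open Set Function
open CategoryTheory.Limits
open Literature.AlgebraicTopology.SingularHomology
open Literature.Topology.FourManifolds Literature.Topology.FourManifolds.LefschetzBase
open Literature.GroupTheory.CombinatorialGroupTheory.SignedHurwitz

-- the prescribed namespace `Summit.<P>.<Sub>.…` duplicates `SmoothPoincare4` (P = Sub)
set_option linter.dupNamespace false

namespace Summit.SmoothPoincare4.SmoothPoincare4.Theorems.AcyclicBisectionRigidity.FoldedCurveBranchLocus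


section Bookkeeping

open Summit.SmoothPoincare4.SmoothPoincare4.Theorems.AcyclicBisectionExists.ModpBraidOrbits

variable {g : ℕ}

/-- `ratWord` is the change of coefficients along `ℤ → ℚ`. [folklore] -/
theorem ratWord_eq_mapWord' (l : IntWord g) :
    ratWord l = mapWord (fun (v : Fin g ⊕ Fin g → ℤ) i => Int.castRingHom ℚ (v i)) l := rfl

/-- Trivial integral signed monodromy stays trivial over `ℚ` (adapted from line `modp-braid-orbits`,
`wordProduct_ratWord_eq_one`). [folklore] -/
theorem wordProduct_ratWord_eq_one' {l : IntWord g} (h : wordProduct (stdSymp ℤ g) l = 1) :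
    wordProduct (stdSymp ℚ g) (ratWord l) = 1 := by
  refine (Pi.basisFun ℚ (Fin g ⊕ Fin g)).ext fun i => ?_
  have key := map_wordProduct (Int.castRingHom ℚ) g l (Pi.single i 1)
  rw [h] at key
  have hb : (Pi.basisFun ℚ (Fin g ⊕ Fin g)) i =
      fun j => Int.castRingHom ℚ ((Pi.single i (1 : ℤ) : _ → ℤ) j) := by
    ext j; simp [Pi.basisFun_apply, Pi.single_apply]
  rw [hb, ratWord_eq_mapWord', ← key]
  rfl

/-- The classes of a word are the first components of its letters. [folklore] -/
theorem letters_eq_range {V : Type*} (l : List (V × Bool)) :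
    letters l = Set.range (fun i : Fin l.length => (l.get i).1) := by
  ext v
  simp only [letters, Set.mem_setOf_eq, Set.mem_range]
  constructor
  · rintro ⟨s, hs⟩
    obtain ⟨i, hi⟩ := List.get_of_mem hs
    exact ⟨i, by rw [hi]⟩
  · rintro ⟨i, rfl⟩
    exact ⟨(l.get i).2, List.get_mem l i⟩

/-- The rational shadows of a word, as a range over its positions, are the classes of its
rationalisation. [folklore] -/
theorem range_ratShadow_eq (P : List ((Fin g ⊕ Fin g → ℤ) × Bool)) :
    (Set.range fun i : Fin P.length => fun j : Fin g ⊕ Fin g => ((P.get i).1 j : ℚ)) =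
      letters (ratWord P) := by
  rw [ratWord, letters_mapWord, letters_eq_range, ← Set.range_comp]
  rfl

/-- In a word all of whose letters are negative, the negative classes are all the classes. [folklore] -/
theorem classesOfSign_false_eq_letters_of_forall {V : Type*} {N : List (V × Bool)}
    (hN : ∀ x ∈ N, x.2 = false) : classesOfSign N false = letters N := by
  ext v
  simp only [classesOfSign, letters, Set.mem_setOf_eq]
  constructor
  · intro h; exact ⟨false, h⟩
  · rintro ⟨s, hs⟩
    have := hN _ hs
    simp only at this
    subst this
    exact hs

/-- In a word all of whose letters are positive there are no negative classes. [folklore] -/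
theorem classesOfSign_false_eq_empty_of_forall {V : Type*} {P : List (V × Bool)}
    (hP : ∀ x ∈ P, x.2 = true) : classesOfSign P false = ∅ := by
  ext v
  simp only [classesOfSign, Set.mem_setOf_eq, Set.mem_empty_iff_false, iff_false]
  intro h
  have := hP _ h
  simp at this

/-- The negative classes of a sorted word `P ++ N` are the classes of `N`. [folklore] -/
theorem classesOfSign_false_sorted {V : Type*} {P N : List (V × Bool)} (hP : ∀ x ∈ P, x.2 = true)
    (hN : ∀ x ∈ N, x.2 = false) : classesOfSign (P ++ N) false = letters N := by
  rw [classesOfSign_append, classesOfSign_false_eq_empty_of_forall hP,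
    classesOfSign_false_eq_letters_of_forall hN, Set.empty_union]

end Bookkeeping

open Summit.SmoothPoincare4.SmoothPoincare4.Theorems.AcyclicBisectionExists.ModpBraidOrbits in
/-- **The folded normal form of a homotopy 4-sphere, from the four facts** (the conclusion of the planner's Stub A of
line `folded-curve-branch-locus`, reached WITHOUT any Stein bisection; found by worker A of lead a4, kernel-checked here for `M ≃ₕ S⁴` with the TREE's facts NF1–NF4, exactly as
`stub_sortedModelOfHandleSplitting_of` of crux 10508 does): every Hausdorff second-countable `C^∞`
4-manifold `M ≃ₕ S⁴` has a SORTED, ALLOWABLE, BALANCED (`|P| = |N| = 2g`), BI-SPANNING fibred Lefschetz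
model `ModelsOnFibred M g (P ++ N)`.  Chain: compact / connected / orientable (proved homotopy-sphere facts)
→ NF1 an allowable fibred model `(g, l)` → NF2 `|l| = 4g`, classes span, `wordProduct l = 1`; NF3 `2g`
positive → `stub_exchange` (positive classes spanning inside `Reach`) → `stub_reachInvariants` (monodromy
stays trivial) → `stub_sortBiSpan` over `ℚ` → `hurwitzOrbit_lift` → NF4 (still a fibred model).  NOTE: the
Stein bisection of the crux plays NO role — this is why Stub B is SPC4-equivalent (certificates at the end).
[cite: EtnyreFuller2006, Thm. 1, Prop. 12, eq. (d3)] [cite: Baykur2006, Lemma 1 and §5] -/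
theorem helper_foldedNormalForm_of_facts :
    modelsOnFibred_exists → modelsOn_counts_of_homotopyEquiv_sphere →
    modelsOnFibred_balance_of_homotopyEquiv_sphere → modelsOnFibred_of_reach →
    ∀ (M : Type) [TopologicalSpace M] [T2Space M] [SecondCountableTopology M]
      [ChartedSpace (EuclideanSpace ℝ (Fin 4)) M] [IsManifold (𝓡 4) ∞ M],
      M ≃ₕ Metric.sphere (0 : EuclideanSpace ℝ (Fin 5)) 1 →
    ∃ (g : ℕ) (P N : List ((Fin g ⊕ Fin g → ℤ) × Bool)),
      (∀ x ∈ P, x.2 = true) ∧ (∀ x ∈ N, x.2 = false) ∧ (∀ x ∈ P ++ N, x.1 ≠ 0) ∧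
      P.length = 2 * g ∧ N.length = 2 * g ∧
      Submodule.span ℚ (Set.range fun i : Fin P.length =>
        fun j : Fin g ⊕ Fin g => ((P.get i).1 j : ℚ)) = ⊤ ∧
      Submodule.span ℚ (Set.range fun i : Fin N.length =>
        fun j : Fin g ⊕ Fin g => ((N.get i).1 j : ℚ)) = ⊤ ∧
      ModelsOnFibred M g (P ++ N) := by
  intro h₁ h₂ h₃ h₄ M _ _ _ _ _ e
  -- `M` is compact, connected, orientable (proved homotopy-sphere facts of the tree)
  haveI : CompactSpace M := compactSpace_of_homotopyEquiv_sphere_four_holds M e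
  haveI : PathConnectedSpace (Metric.sphere (0 : EuclideanSpace ℝ (Fin 5)) 1) :=
    pathConnectedSpace_sphere_four
  haveI : PathConnectedSpace M := pathConnectedSpace_of_homotopyEquiv e
  have hor : IsOrientable (𝓡 4) M := isOrientable_of_homotopyEquiv_sphere_four_holds M e
  -- NF1: an allowable fibred model
  obtain ⟨g, l, hnz, hfib⟩ := h₁ M hor
  -- NF2, NF3: counts and balance of a homotopy sphere
  obtain ⟨hlen, hspan, hprod⟩ := h₂ M g l e hfib.modelsOn
  have hbal : (l.filter (·.2)).length = 2 * g := h₃ M g l e hfib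
  -- the exchange engine: positive classes spanning, inside the `Reach`-class
  obtain ⟨g', l', hreach, hlen', hbal', hpos'⟩ := stub_exchange g l hlen hbal hnz hspan
  -- trivial monodromy persists and descends to `ℚ`
  have hprodQ : wordProduct (stdSymp ℚ g') (ratWord l') = 1 :=
    wordProduct_ratWord_eq_one' (stub_reachInvariants g l g' l' hreach hprod)
  -- bi-span sorting over `ℚ` inside the Hurwitz orbit
  obtain ⟨m', hm', hsorted', hposQ, hnegQ⟩ := stub_sortBiSpan ℚ g' (ratWord l') (ratWord l')
    (by rw [ratWord, length_mapWord, hlen']) (by rw [ratWord, length_filter_mapWord, hbal']) hprodQ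
    (HurwitzOrbit.refl _ _) hpos'
  -- lift to the integral orbit
  obtain ⟨l'', hl'', hrat⟩ := hurwitzOrbit_lift (Int.castRingHom ℚ) g' l' (m := m')
    (by rwa [← ratWord_eq_mapWord'])
  rw [← ratWord_eq_mapWord'] at hrat
  subst hrat
  have hsorted : Sorted l'' := Sorted.of_mapWord _ hsorted'
  have hreach'' : Reach g l g' l'' := hreach.trans_hurwitzOrbit hl''
  -- NF4: still a fibred model; bookkeeping along `Reach`
  have hfib'' : ModelsOnFibred M g' l'' := h₄ M g l g' l'' hfib hreach''
  have hnz'' : ∀ x ∈ l'', x.1 ≠ 0 := hreach''.forall_ne_zero hnz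
  have hlen'' : l''.length = 4 * g' := hreach''.length_eq_four_mul hlen
  have hbal'' : (l''.filter (·.2)).length = 2 * g' := hreach''.length_filter_eq_two_mul hbal
  obtain ⟨P, N, rfl, hP, hN⟩ := hsorted
  have hlenP : P.length = 2 * g' := by rw [← hbal'', filter_snd_sorted hP hN]
  have hlenN : N.length = 2 * g' := by
    rw [List.length_append] at hlen''
    omega
  have hposQ' : Submodule.span ℚ (letters (ratWord P)) = ⊤ := by
    have e : classesOfSign (ratWord (P ++ N)) true = letters (ratWord P) := by
      rw [ratWord, mapWord_append]
      exact classesOfSign_true_sorted (forall_snd_mapWord _ hP) (forall_snd_mapWord _ hN)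
    rw [← e]; exact hposQ
  have hnegQ' : Submodule.span ℚ (letters (ratWord N)) = ⊤ := by
    have e : classesOfSign (ratWord (P ++ N)) false = letters (ratWord N) := by
      rw [ratWord, mapWord_append]
      exact classesOfSign_false_sorted (forall_snd_mapWord _ hP) (forall_snd_mapWord _ hN)
    rw [← e]; exact hnegQ
  refine ⟨g', P, N, hP, hN, hnz'', hlenP, hlenN, ?_, ?_, hfib''⟩
  · rw [range_ratShadow_eq]; exact hposQ'
  · rw [range_ratShadow_eq]; exact hnegQ'

/-- **Fold recognition in every genus ⇒ SPC4, modulo the four Lefschetz facts** (sorry-free: the facts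
and the recognition statement — the line's `FoldRecognition g` for all `g`, written out — are
hypotheses).  With the trivial converse (`SmoothPoincare4` implies every statement of the shape
`∀ M ≃ₕ S⁴, P M → M ≅ S⁴`) the line's Transfer `C⁺` is the summit in costume. [folklore] -/
theorem helper_spc4_of_foldRecognition_of_facts :
    modelsOnFibred_exists → modelsOn_counts_of_homotopyEquiv_sphere →
    modelsOnFibred_balance_of_homotopyEquiv_sphere → modelsOnFibred_of_reach →
    (∀ (g : ℕ) (M : Type) [TopologicalSpace M] [T2Space M] [SecondCountableTopology M]
      [ChartedSpace (EuclideanSpace ℝ (Fin 4)) M] [IsManifold (𝓡 4) ∞ M],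
      M ≃ₕ Metric.sphere (0 : EuclideanSpace ℝ (Fin 5)) 1 →
      ∀ (P N : List ((Fin g ⊕ Fin g → ℤ) × Bool)),
        (∀ x ∈ P, x.2 = true) → (∀ x ∈ N, x.2 = false) → (∀ x ∈ P ++ N, x.1 ≠ 0) →
        P.length = 2 * g → N.length = 2 * g →
        Submodule.span ℚ (Set.range fun i : Fin P.length =>
          fun j : Fin g ⊕ Fin g => ((P.get i).1 j : ℚ)) = ⊤ →
        Submodule.span ℚ (Set.range fun i : Fin N.length =>
          fun j : Fin g ⊕ Fin g => ((N.get i).1 j : ℚ)) = ⊤ →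
        ModelsOnFibred M g (P ++ N) →
        Nonempty (M ≃ₘ⟮𝓡 4, 𝓡 4⟯ Metric.sphere (0 : EuclideanSpace ℝ (Fin 5)) 1)) →
    SmoothPoincare4 := by
  intro h₁ h₂ h₃ h₄ hR M _ _ _ _ _ e
  obtain ⟨g, P, N, hP, hN, hnz, hlP, hlN, hsP, hsN, hmodel⟩ :=
    helper_foldedNormalForm_of_facts h₁ h₂ h₃ h₄ M e
  exact hR g M e P N hP hN hnz hlP hlN hsP hsN hmodel

/-- **The genus-`1` rung from Matsumoto's normal form (pure logic over the reshaped stubs).**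
Hypotheses, in order: NF2 `modelsOn_counts_of_homotopyEquiv_sphere`, NF4 `modelsOnFibred_of_reach`, Cerf
`cerf_twistedSphere_four`, and the statements of the skeleton's `stub_genusOnePrimitive` (page curves with
non-zero shadow are primitive), `stub_matsumotoNormalForm` (Matsumoto 1985 Thm. 3.2 for four letters),
`stub_genusOneDet` (`|u × w| = 1` for a homotopy sphere), `stub_genusOneTopRecognition` (the normal-form
model with `|u × w| = 1` is a twisted sphere, standard by Cerf); conclusion: the registered
`stub_genusOneFold` verbatim (genus-`1` folds of homotopy 4-spheres are standard).
[cite: Matsumoto1985, Thm. 3.2] -/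
theorem helper_genusOneFold_of_stubs :
    modelsOn_counts_of_homotopyEquiv_sphere → modelsOnFibred_of_reach → cerf_twistedSphere_four →
    (∀ (M : Type) [TopologicalSpace M] [T2Space M] [SecondCountableTopology M]
      [ChartedSpace (EuclideanSpace ℝ (Fin 4)) M] [IsManifold (𝓡 4) ∞ M] (l : IntWord 1),
      ModelsOnFibred M 1 l → ∀ x ∈ l, x.1 ≠ 0 → IsPrimitive x.1) →
    (∀ (l : IntWord 1), l.length = 4 → (∀ x ∈ l, IsPrimitive x.1) →
      wordProduct (stdSymp ℤ 1) l = 1 →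
      ∃ (u w : Fin 1 ⊕ Fin 1 → ℤ) (η η' : Bool),
        HurwitzOrbit (stdSymp ℤ 1) l [(u, η), (u, !η), (w, η'), (w, !η')]) →
    (∀ (M : Type) [TopologicalSpace M] [T2Space M] [SecondCountableTopology M]
      [ChartedSpace (EuclideanSpace ℝ (Fin 4)) M] [IsManifold (𝓡 4) ∞ M],
      M ≃ₕ Metric.sphere (0 : EuclideanSpace ℝ (Fin 5)) 1 →
      ∀ (u w : Fin 1 ⊕ Fin 1 → ℤ) (η η' : Bool),
      ModelsOnFibred M 1 [(u, η), (u, !η), (w, η'), (w, !η')] →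
      (stdSymp ℤ 1 u w = 1 ∨ stdSymp ℤ 1 u w = -1)) →
    (cerf_twistedSphere_four →
      ∀ (M : Type) [TopologicalSpace M] [T2Space M] [SecondCountableTopology M]
        [ChartedSpace (EuclideanSpace ℝ (Fin 4)) M] [IsManifold (𝓡 4) ∞ M]
        (u w : Fin 1 ⊕ Fin 1 → ℤ) (η η' : Bool),
        (stdSymp ℤ 1 u w = 1 ∨ stdSymp ℤ 1 u w = -1) →
        ModelsOnFibred M 1 [(u, η), (u, !η), (w, η'), (w, !η')] →
        Nonempty (M ≃ₘ⟮𝓡 4, 𝓡 4⟯ Metric.sphere (0 : EuclideanSpace ℝ (Fin 5)) 1)) →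
    ∀ (M : Type) [TopologicalSpace M] [T2Space M] [SecondCountableTopology M]
      [ChartedSpace (EuclideanSpace ℝ (Fin 4)) M] [IsManifold (𝓡 4) ∞ M],
      M ≃ₕ Metric.sphere (0 : EuclideanSpace ℝ (Fin 5)) 1 →
    ∀ (P N : List ((Fin 1 ⊕ Fin 1 → ℤ) × Bool)),
      (∀ x ∈ P, x.2 = true) → (∀ x ∈ N, x.2 = false) → (∀ x ∈ P ++ N, x.1 ≠ 0) →
      P.length = 2 * 1 → N.length = 2 * 1 →
      Submodule.span ℚ (Set.range fun i : Fin P.length =>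
        fun j : Fin 1 ⊕ Fin 1 => ((P.get i).1 j : ℚ)) = ⊤ →
      Submodule.span ℚ (Set.range fun i : Fin N.length =>
        fun j : Fin 1 ⊕ Fin 1 => ((N.get i).1 j : ℚ)) = ⊤ →
      ModelsOnFibred M 1 (P ++ N) →
      Nonempty (M ≃ₘ⟮𝓡 4, 𝓡 4⟯ Metric.sphere (0 : EuclideanSpace ℝ (Fin 5)) 1) := by
  intro hNF2 hNF4 hcerf hprim hmats hdet htop M _ _ _ _ _ e P N _ _ hnz hlP hlN _ _ hmodel
  -- NF2: the signed monodromy of a model of a homotopy sphere is trivial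
  obtain ⟨-, -, hprod⟩ := hNF2 M 1 (P ++ N) e hmodel.modelsOn
  -- letters are primitive
  have hprim' : ∀ x ∈ P ++ N, IsPrimitive x.1 :=
    fun x hx => hprim M (P ++ N) hmodel x hx (hnz x hx)
  -- Matsumoto's normal form in the signed Hurwitz orbit
  have hlen : (P ++ N).length = 4 := by rw [List.length_append, hlP, hlN]
  obtain ⟨u, w, η, η', horb⟩ := hmats (P ++ N) hlen hprim' hprod
  -- NF4: the normal form still models `M`
  have hmodel' : ModelsOnFibred M 1 [(u, η), (u, !η), (w, η'), (w, !η')] :=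
    hNF4 M 1 (P ++ N) 1 _ hmodel (Reach.of_hurwitzOrbit horb)
  exact htop hcerf M u w η η' (hdet M e u w η η' hmodel') hmodel'

end Summit.SmoothPoincare4.SmoothPoincare4.Theorems.AcyclicBisectionRigidity.FoldedCurveBranchLocus

end
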